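import Mathlib
import Mathlib.MeasureTheory.Function.LpSeminorm.Basic
import Mathlib.MeasureTheory.Function.LocallyIntegrable
import Literature.Analysis.FluidPDE.SelfSimilar
import Literature.Analysis.FluidPDE.MildSolution
import Literature.Analysis.FluidPDE.SuitableWeak
import Literature.Analysis.FluidPDE.AxisymmetricEuler
import Literature.Analysis.FluidPDE.NSWave0
import HarnessLib.Audit
import HarnessLib

/-!
# AxisymmetricLiouvilleBoundedSwirl — CONJECTURE (obligation of NavierStokesRegularity/NavierStokesRegularity)

Unproven conjecture migrated by the gate from `Literature/Analysis/FluidPDE/SelfSimilarLiouville.lean` (`Literature.Analysis.FluidPDE.AxisymmetricLiouvilleBoundedSwirl`): unproven conjectures are obligations of our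
theories, not literature facts (human ruling 2026-08-15). Provenance: KochNadirashviliSereginSverak2009. Routes use it as a crux item or via
`--conditional-bridge --conditional-on AxisymmetricLiouvilleBoundedSwirl`; a proof goes in the sibling `Theorems/AxisymmetricLiouvilleBoundedSwirlHolds.lean` as `theorem AxisymmetricLiouvilleBoundedSwirl_holds : AxisymmetricLiouvilleBoundedSwirl` so this file stays a conjecture LEAF that Literature/ may import.
-/

namespace Summit.NavierStokesRegularity.NavierStokesRegularity

open Literature Literature.Analysis Literature.Analysis.FluidPDE
open MeasureTheory Set Function Filter Topology TopologicalSpace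
open scoped ContDiff NNReal ENNReal InnerProductSpace RealInnerProductSpace
local notation "ℝ³" => EuclideanSpace ℝ (Fin 3)

/-- **ns.S25** (AX-L) (Liouville problem for axisymmetric bounded ancient solutions with bounded
swirl; wall `summits/ns-w-axisym-swirl/SUMMIT.md`). **Open problem** — a `def`, not a fact:
nothing in print proves this statement (status checked 2026-08 against the sources below).
**Provenance.** Koch–Nadirashvili–Seregin–Šverák, Acta Math. 203 (2009) = arXiv:0709.3599, §5,
arXiv p. 10, between the proof of Theorem 5.2 and Theorem 5.3: "The validity of Theorem 5.2 in
the absence of the 'no swirl' assumption is still an open problem. The following theorem,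
however, is a partial result in that direction" (Theorem 5.3 = `knss_bound_C_over_r`: under
`|u| ≤ C/r` one gets `u = 0`); Seregin–Šverák, Comm. PDE 34 (2009) = arXiv:0804.1803, p. 3: "we
have not been able to fully prove Conjecture (L) in the axi-symmetric case so far". KNSS's open
problem carries *no* bound on the swirl; the present statement is its sub-problem with the extra
hypothesis `Γ = r u_θ ∈ L^∞`, the form studied by Lei–Ren–Zhang (arXiv:1902.11229, §1, remark
after Thm 1.1: `Γ` obeys the maximum principle and is scaling invariant, so an `L^∞` bound
persists from the data and survives blow-up limits — "essentially not a restriction"; Zhang–Pan,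
Anal. Theory Appl. 38 (2022), §3: "one can add the extra condition `Γ ∈ L^∞_t L^∞_x` without
losing much generality"). **Partial results in print** (none reaches this statement): KNSS 2009,
Thm 5.3 (`|u| ≤ C/r`); Lei–Zhang–Zhao 2017 (`Γ ∈ L^∞_t L^p_x` for some `p < ∞` forces `u`
constant; Zhang–Pan 2022, Thm 3.5); Lei–Ren–Zhang arXiv:1902.11229, Thm 1.1 (= Math. Ann. 383
(2022) 415–431: if moreover `u` is periodic in `z` then `u = c e_z`) and Thm 1.2 (= Sci. Sin.
Math. 51 (2021) 971–984: under the rate condition `|Γ² − limsup_{r→∞} Γ²| ≤ ε₀ r⁻¹ limsup Γ²`);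
Zhang–Pan 2022, p. 12: "the remaining case for the Liouville property, which is also the most
difficult one, is when `Γ` does not decay near infinity … the result cannot yet reach the full
conjecture in [KNSS]". **Statement.** Every bounded ancient mild solution
`u ∈ L^∞(ℝ³ × (−∞, 0))` (measurable slices) of Navier–Stokes (`ν = 1`) which is axisymmetric at
every `t < 0` and whose swirl `Γ = r u_θ = x₀u₁ − x₁u₀` (`swirl`, junk-free) is bounded on
`(−∞, 0) × ℝ³` is constant — spatially a.e. constant on every slice `t < 0`, the rendering of
"constant" forced by the duality-form class (module docstring; KNSS 2009, Thm 5.2 likewise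
concludes `(0, 0, b(t))`). As for `knss_axisymmetric_no_swirl` versus
`knss2009_axisymmetric_no_swirl`, the slice-wise measurability class is slightly larger than
print's jointly measurable `L^∞(ℝ³ × (−∞, 0))`; for an open `Prop` this only strengthens the
conjecture recorded. With `Γ ≡ 0` this is (the `ℝ³`-valued form of) Theorem 5.2
(`AxisymmetricLiouvilleBoundedSwirl.of_hasNoSwirl`), and conjecture (L) implies it
(`LiouvilleConjectureNS.axisymmetricLiouvilleBoundedSwirl`). [cite: KochNadirashviliSereginSverak2009, §5, arXiv p. 10 (after Thm 5.2): stated OPEN without the no-swirl assumption; bounded-Γ form Lei–Ren–Zhang arXiv:1902.11229 §1; status Zhang–Pan 2022 §3] -/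
@[conjecture] def AxisymmetricLiouvilleBoundedSwirl : Prop :=
  ∀ u : ℝ → ℝ³ → ℝ³, FluidPDE.IsBoundedAncientMildSolution 1 u →
    (∀ t < 0, AEStronglyMeasurable (u t) volume) →
      (∀ t < 0, FluidPDE.IsAxisymmetric (u t)) →
        (∃ C : ℝ, ∀ t < 0, ∀ x, |FluidPDE.swirl (u t) x| ≤ C) →
          ∀ t < 0, ∃ b : ℝ³, u t =ᵐ[volume] fun _ => b

end Summit.NavierStokesRegularity.NavierStokesRegularity
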